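import Literature.MathematicalPhysics.QuantumLattice.TorusSectorPressureTypeBoundAllTori
import Literature.MathematicalPhysics.QuantumLattice.SpinSectorPartitionFnParticleHole
import HarnessLib

/-!
# The type-class pressure floor on the ELECTRON-doped side from HOLE-doped open-box data
# (particle–hole transport of certificate C2, every torus)

Family `hubbard` (topic `MathematicalPhysics/QuantumLattice`); seat `hubbard-downfold-unc-2` (cell
`pub/hubbard-downfold`, row «FILLING direction of BOX → WORD», electron-doped half at `T > 0`). Companion of
`TorusSectorPressureTypeBoundAllTori` (the C2 floor: certified open-box canonical partition functions
`0 < z_s ≤ Re Z_β(H^{open}_{a×b}(t, t', U); s)`, `s ∈ S`, and a balanced TYPE `m` (`Σ m_s = q`,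
`Σ m_s s.1 = Σ m_s s.2 = A₀`, density `n·(qab) = 2A₀`) give, along EVERY sequence of tori `Ls → ∞`,
`∀ ε > 0, ∀ᶠ j, (W - ε)(Ls j)² ≤ log Re Z_β(sectorHamiltonianTT' t t' U n (Ls j))`,
`W = (q log q - Σ m_s log m_s + Σ m_s log z_s)/(qab)`) and of `SpinSectorPartitionFnParticleHole` (the open
cluster is bipartite for ANY sides: `Re Z_β(H^{open}(t, t', U); p, q) = e^{βU(ab - p - q)} · Re Z_β(H^{open}(t, -t', U);
ab - p, ab - q)`).

Putting the two together: the certified sidecar of the HOLE-doped sectors `(ab - s.1, ab - s.2)` of the cluster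
`H^{open}_{a×b}(t, -t', U)` — the object the certificate producers of stage S2 compute for the cuprate sign of `t'`
read on the hole-doped side — IS a certified sidecar of the ELECTRON-doped sectors `s` of `H^{open}_{a×b}(t, t', U)`,
with `z_s ↦ e^{βU(ab - s.1 - s.2)} z_s`; for a balanced type `m` on the electron-doped sectors (density `n`,
typically `n > 1`) the all-tori floor reads

  `∀ ε > 0, ∀ᶠ j, (W + βU(1 - n) - ε)(Ls j)² ≤ log Re Z_β(sectorHamiltonianTT' t t' U n (Ls j))`,

`W` computed with the HOLE-doped floors `z_s` (`InfVolFermionState.eventually_typeFreeEntropy_mul_sq_le_log_partitionFn_allTori_of_particleHole`;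
the shift `βU(1 - n) = -βU(n - 1)` is the free-energy image of the `T = 0` dictionary
`e(t, t', U, n) = e(t, -t', U, 2 - n) + U(n - 1)`, `energyDensityTT'_particleHole`). No torus particle–hole
symmetry is used (odd tori are not bipartite): the reflection happens inside the open boxes, the tiling to
every torus is the all-tori theorem's. Finite-volume form first (`typeFreeEntropy_mul_sq_sub_linear_le_log_partitionFn_of_particleHole`).

Everything is PROVED; no definition, no named fact, no sorry. HONEST LIMITS: a lower bound on the canonical
sector pressure only (trial-state floors transported); the type is supplied on the electron-doped sectors (reflect a
hole-doped type `s ↦ (ab - s.1, ab - s.2)`, same multiplicities, `A₀ ↦ q·ab - A₀`); no number.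

## References

* E. H. Lieb, F. Y. Wu, Physica A 321 (2003) 1, §1 eq. (3) (the spin-resolved particle–hole map of the sectors,
  `(M, M') ↦ (N_a - M, N_a - M')`, with the energy shift `-(N_a - N)U`). [cite: LiebWuPhysicaA2003, §1 eq. (3)]
* D. Ruelle, *Statistical Mechanics: Rigorous Results* (1969), §2.4 and §3.4 (pressure / free energy from
  sub-box partition functions; canonical vs grand-canonical thermodynamic functions). [cite: Ruelle1969, §3.4]
* R. B. Israel, *Convexity in the Theory of Lattice Gases* (1979), §I.3 eq. (26) and Lemma II.3.1 (finite-volume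
  partition functions, product trial states). [cite: Israel1979, §I.3 eq. (26)]

## Mathlib / tree search

REUSED: `InfVolFermionState.eventually_typeFreeEntropy_mul_sq_le_log_partitionFn_allTori`,
`typeFreeEntropy_mul_sq_sub_linear_le_log_partitionFn` (`TorusSectorPressureTypeBoundAllTori`);
`mul_le_partitionFn_spinSector_hubbardOpenBoxTT'_re_of_particleHole` (`SpinSectorPartitionFnParticleHole`);
`Real.log_mul`, `Real.log_exp`, `Finset.sum_add_distrib`, `Finset.mul_sum`.
-/

noncomputable section

namespace Literature.MathematicalPhysics.QuantumLattice

open Matrix Finset HubbardWave0 ThermodynamicLimit LiebThm1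
open _root_.Filter
open scoped ComplexOrder BigOperators Topology

section ParticleHole

variable {a b : ℕ}

/-- The reflected floors: `z'_s = e^{βU(ab - s.1 - s.2)} · z_s` is positive with `z_s`. [folklore] -/
private theorem reflectedFloor_pos (β U : ℝ) (a b : ℕ) {S : Finset (ℕ × ℕ)} {z : ℕ × ℕ → ℝ}
    (hz0 : ∀ s ∈ S, 0 < z s) :
    ∀ s ∈ S, 0 < Real.exp (β * U * ((a : ℝ) * b - s.1 - s.2)) * z s :=
  fun s hs => mul_pos (Real.exp_pos _) (hz0 s hs)

/-- The reflected floors ARE floors of the electron-doped sectors of the `t'` cluster: HOLE-doped data of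
`H^{open}(t, -t', U)` at `(ab - s.1, ab - s.2)` bound `Re Z_β(H^{open}(t, t', U); s)` from below.
[cite: LiebWuPhysicaA2003, §1 eq. (3)] -/
theorem reflectedFloor_le_partitionFn_spinSector_hubbardOpenBoxTT'_re (β t t' U : ℝ) (a b : ℕ)
    {S : Finset (ℕ × ℕ)} (hS : ∀ s ∈ S, s.1 ≤ a * b ∧ s.2 ≤ a * b) {z : ℕ × ℕ → ℝ}
    (hz : ∀ s ∈ S, z s ≤ (partitionFn β (spinSectorHamiltonian (a * b - s.1) (a * b - s.2)
      (hubbardOpenBoxTT' a b t (-t') U))).re) :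
    ∀ s ∈ S, Real.exp (β * U * ((a : ℝ) * b - s.1 - s.2)) * z s ≤
      (partitionFn β (spinSectorHamiltonian s.1 s.2 (hubbardOpenBoxTT' a b t t' U))).re := by
  intro s hs
  obtain ⟨h1, h2⟩ := hS s hs
  exact mul_le_partitionFn_spinSector_hubbardOpenBoxTT'_re_of_particleHole a b β t t' U
    (p := s.1) (q := s.2) (p' := a * b - s.1) (q' := a * b - s.2) (by omega) (by omega) (hz s hs)

/-- **The type free entropy of the reflected floors** is the type free entropy of the hole-doped floors shifted by
`βU(q·ab - 2A₀)`: `Σ m_s log(e^{βU(ab - s.1 - s.2)} z_s) = Σ m_s log z_s + βU(q·ab - A₀ - A₀)` for a balanced type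
(`Σ m_s = q`, `Σ m_s s.1 = Σ m_s s.2 = A₀`). [cite: LiebWuPhysicaA2003, §1 eq. (3)] -/
theorem sum_mul_log_reflectedFloor (β U : ℝ) (a b : ℕ) {S : Finset (ℕ × ℕ)} (m : ℕ × ℕ → ℕ) {q A₀ : ℕ}
    (hsum : ∑ s ∈ S, m s = q) (hA : ∑ s ∈ S, m s * s.1 = A₀) (hB : ∑ s ∈ S, m s * s.2 = A₀)
    {z : ℕ × ℕ → ℝ} (hz0 : ∀ s ∈ S, 0 < z s) :
    ∑ s ∈ S, (m s : ℝ) * Real.log (Real.exp (β * U * ((a : ℝ) * b - s.1 - s.2)) * z s) =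
      ∑ s ∈ S, (m s : ℝ) * Real.log (z s) + β * U * ((q : ℝ) * (a * b) - A₀ - A₀) := by
  have hlog : ∀ s ∈ S, Real.log (Real.exp (β * U * ((a : ℝ) * b - s.1 - s.2)) * z s) =
      β * U * ((a : ℝ) * b - s.1 - s.2) + Real.log (z s) := fun s hs => by
    rw [Real.log_mul (Real.exp_pos _).ne' (hz0 s hs).ne', Real.log_exp]
  have hq : (q : ℝ) = ∑ s ∈ S, (m s : ℝ) := by rw [← hsum]; push_cast; rfl
  have hA' : (A₀ : ℝ) = ∑ s ∈ S, (m s : ℝ) * (s.1 : ℝ) := by rw [← hA]; push_cast; rfl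
  have hB' : (A₀ : ℝ) = ∑ s ∈ S, (m s : ℝ) * (s.2 : ℝ) := by rw [← hB]; push_cast; rfl
  calc ∑ s ∈ S, (m s : ℝ) * Real.log (Real.exp (β * U * ((a : ℝ) * b - s.1 - s.2)) * z s)
      = ∑ s ∈ S, ((m s : ℝ) * Real.log (z s) +
          β * U * ((m s : ℝ) * ((a : ℝ) * b) - (m s : ℝ) * (s.1 : ℝ) - (m s : ℝ) * (s.2 : ℝ))) := by
        refine Finset.sum_congr rfl fun s hs => ?_
        rw [hlog s hs]
        ring
    _ = ∑ s ∈ S, (m s : ℝ) * Real.log (z s) + β * U * ((q : ℝ) * (a * b) - A₀ - A₀) := by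
        rw [Finset.sum_add_distrib, ← Finset.mul_sum, Finset.sum_sub_distrib, Finset.sum_sub_distrib,
          ← Finset.sum_mul, ← hq]
        nth_rewrite 2 [hA']
        rw [hB']
        ring

/-- **The type pressure floor reflects with the shift `βU(1 - n)`**: for a balanced type of density `n`
(`n·(qab) = 2A₀`), `W(z') = W(z) + βU(1 - n)` where `z'` are the reflected floors.
[cite: LiebWuPhysicaA2003, §1 eq. (3)] -/
theorem typeFreeEntropy_reflectedFloor (β U n : ℝ) {a b : ℕ} (ha : 1 ≤ a) (hb : 1 ≤ b) {S : Finset (ℕ × ℕ)}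
    (m : ℕ × ℕ → ℕ) {q A₀ : ℕ} (hq1 : 1 ≤ q) (hsum : ∑ s ∈ S, m s = q) (hA : ∑ s ∈ S, m s * s.1 = A₀)
    (hB : ∑ s ∈ S, m s * s.2 = A₀) (hn : n * ((q : ℝ) * a * b) = 2 * A₀) {z : ℕ × ℕ → ℝ}
    (hz0 : ∀ s ∈ S, 0 < z s) :
    ((q : ℝ) * Real.log q - ∑ s ∈ S, (m s : ℝ) * Real.log (m s) +
        ∑ s ∈ S, (m s : ℝ) * Real.log (Real.exp (β * U * ((a : ℝ) * b - s.1 - s.2)) * z s)) / ((q : ℝ) * a * b) =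
      ((q : ℝ) * Real.log q - ∑ s ∈ S, (m s : ℝ) * Real.log (m s) + ∑ s ∈ S, (m s : ℝ) * Real.log (z s)) /
          ((q : ℝ) * a * b) + β * U * (1 - n) := by
  rw [sum_mul_log_reflectedFloor β U a b m hsum hA hB hz0]
  have hqab : (0 : ℝ) < (q : ℝ) * a * b := by
    have h1 : (1 : ℝ) ≤ q := by exact_mod_cast hq1
    have h2 : (1 : ℝ) ≤ a := by exact_mod_cast ha
    have h3 : (1 : ℝ) ≤ b := by exact_mod_cast hb
    positivity
  have hA₀ : (A₀ : ℝ) = n * ((q : ℝ) * a * b) / 2 := by rw [hn]; ring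
  rw [hA₀]
  field_simp
  ring

/-- **C2 ON THE ELECTRON-DOPED SIDE, finite volume.** Balanced type `m` on the electron-doped sectors `S` of the
`a × b` cluster of `H(t, t', U)` (density `n·(qab) = 2A₀ ≤ 2·(qab)`), floors `0 < z_s ≤ Re Z_β(H^{open}(t, -t', U);
ab - s.1, ab - s.2)` certified on the HOLE-doped sectors of the `-t'` cluster: for every `L ≥ qa + 1, b + 1`,
`(W + βU(1 - n))·L² - (|W + βU(1 - n)| + βU⁺)(qa + b)·L - |S| log(L² + 1) ≤ log Re Z_β(sectorHamiltonianTT' t t' U n L)`.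
[cite: LiebWuPhysicaA2003, §1 eq. (3)] -/
theorem typeFreeEntropy_mul_sq_sub_linear_le_log_partitionFn_of_particleHole (t t' U n : ℝ) {β : ℝ}
    (hβ : 0 ≤ β) {a b : ℕ} (ha : 1 ≤ a) (hb : 1 ≤ b) (S : Finset (ℕ × ℕ)) (m : ℕ × ℕ → ℕ) {q A₀ : ℕ}
    (hq : 1 ≤ q) (hmS : ∀ s, m s ≠ 0 → s ∈ S) (hsum : ∑ s ∈ S, m s = q) (hA : ∑ s ∈ S, m s * s.1 = A₀)
    (hB : ∑ s ∈ S, m s * s.2 = A₀) (hn : n * ((q : ℝ) * a * b) = 2 * A₀) (hn2 : n ≤ 2)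
    (hS : ∀ s ∈ S, s.1 ≤ a * b ∧ s.2 ≤ a * b) {z : ℕ × ℕ → ℝ} (hz0 : ∀ s ∈ S, 0 < z s)
    (hz : ∀ s ∈ S, z s ≤ (partitionFn β (spinSectorHamiltonian (a * b - s.1) (a * b - s.2)
      (hubbardOpenBoxTT' a b t (-t') U))).re)
    {L : ℕ} (hLa : q * a + 1 ≤ L) (hLb : b + 1 ≤ L) :
    (((q : ℝ) * Real.log q - ∑ s ∈ S, (m s : ℝ) * Real.log (m s) + ∑ s ∈ S, (m s : ℝ) * Real.log (z s)) /
          ((q : ℝ) * a * b) + β * U * (1 - n)) * (L : ℝ) ^ 2 -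
        (|((q : ℝ) * Real.log q - ∑ s ∈ S, (m s : ℝ) * Real.log (m s) + ∑ s ∈ S, (m s : ℝ) * Real.log (z s)) /
            ((q : ℝ) * a * b) + β * U * (1 - n)| + β * max U 0) * ((q * a + b : ℕ) : ℝ) * L -
        S.card * Real.log ((L : ℝ) ^ 2 + 1) ≤
      Real.log (partitionFn β (sectorHamiltonianTT' t t' U n L)).re := by
  have h := typeFreeEntropy_mul_sq_sub_linear_le_log_partitionFn t t' U n hβ ha hb S m hq hmS hsum hA hB hn hn2
    (reflectedFloor_pos β U a b hz0)
    (reflectedFloor_le_partitionFn_spinSector_hubbardOpenBoxTT'_re β t t' U a b hS hz) hLa hLb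
  rwa [typeFreeEntropy_reflectedFloor β U n ha hb m hq hsum hA hB hn hz0] at h

/-- **C2 ON THE ELECTRON-DOPED SIDE, EVERY TORUS LIMIT.** With the data of the previous theorem, along every
`Ls → ∞`: `∀ ε > 0, ∀ᶠ j, (W + βU(1 - n) - ε)(Ls j)² ≤ log Re Z_β(sectorHamiltonianTT' t t' U n (Ls j))` —
the certified HOLE-doped sidecar of `H^{open}_{a×b}(t, -t', U)` bounds the canonical pressure of `H(t, t', U)` at
the reflected (electron-doped) density on every torus, with the free-energy shift `βU(1 - n)` (`W` computed with
the hole-doped floors). This is the `hW` input of the `T`-axis windows (`HubbardThermalAxisWindowAllTori`) and of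
the pressure-floor entropy rows on the electron-doped side. [cite: LiebWuPhysicaA2003, §1 eq. (3)] -/
theorem InfVolFermionState.eventually_typeFreeEntropy_mul_sq_le_log_partitionFn_allTori_of_particleHole
    (t t' U n : ℝ) {β : ℝ} (hβ : 0 ≤ β) {a b : ℕ} (ha : 1 ≤ a) (hb : 1 ≤ b) (S : Finset (ℕ × ℕ))
    (m : ℕ × ℕ → ℕ) {q A₀ : ℕ} (hq : 1 ≤ q) (hmS : ∀ s, m s ≠ 0 → s ∈ S) (hsum : ∑ s ∈ S, m s = q)
    (hA : ∑ s ∈ S, m s * s.1 = A₀) (hB : ∑ s ∈ S, m s * s.2 = A₀) (hn : n * ((q : ℝ) * a * b) = 2 * A₀)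
    (hn2 : n ≤ 2) (hS : ∀ s ∈ S, s.1 ≤ a * b ∧ s.2 ≤ a * b) {z : ℕ × ℕ → ℝ} (hz0 : ∀ s ∈ S, 0 < z s)
    (hz : ∀ s ∈ S, z s ≤ (partitionFn β (spinSectorHamiltonian (a * b - s.1) (a * b - s.2)
      (hubbardOpenBoxTT' a b t (-t') U))).re)
    {Ls : ℕ → ℕ} (hLs : Tendsto Ls atTop atTop) {ε : ℝ} (hε : 0 < ε) :
    ∀ᶠ j in atTop, ((((q : ℝ) * Real.log q - ∑ s ∈ S, (m s : ℝ) * Real.log (m s) +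
        ∑ s ∈ S, (m s : ℝ) * Real.log (z s)) / ((q : ℝ) * a * b) + β * U * (1 - n)) - ε) * (Ls j : ℝ) ^ 2 ≤
      Real.log (partitionFn β (sectorHamiltonianTT' t t' U n (Ls j))).re := by
  have h := InfVolFermionState.eventually_typeFreeEntropy_mul_sq_le_log_partitionFn_allTori t t' U n hβ ha hb S m
    hq hmS hsum hA hB hn hn2 (reflectedFloor_pos β U a b hz0)
    (reflectedFloor_le_partitionFn_spinSector_hubbardOpenBoxTT'_re β t t' U a b hS hz) hLs hε
  rwa [typeFreeEntropy_reflectedFloor β U n ha hb m hq hsum hA hB hn hz0] at h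

/-- **The same floor read with the density of the HOLE-doped type.** If the hole-doped type has density `ρ`
(`ρ·(qab) = 2A_h`, `A_h = q·ab - A₀` the hole-doped first moment), the electron-doped density is `n = 2 - ρ` and the
shift is `βU(1 - n) = -βU(1 - ρ)`: `∀ ε > 0, ∀ᶠ j, (W - βU(1 - ρ) - ε)(Ls j)² ≤ log Re Z_β(sectorHamiltonianTT' t t' U (2 - ρ) (Ls j))`.
[cite: LiebWuPhysicaA2003, §1 eq. (3)] -/
theorem InfVolFermionState.eventually_typeFreeEntropy_mul_sq_le_log_partitionFn_allTori_two_sub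
    (t t' U ρ : ℝ) {β : ℝ} (hβ : 0 ≤ β) {a b : ℕ} (ha : 1 ≤ a) (hb : 1 ≤ b) (S : Finset (ℕ × ℕ))
    (m : ℕ × ℕ → ℕ) {q A₀ A_h : ℕ} (hq : 1 ≤ q) (hmS : ∀ s, m s ≠ 0 → s ∈ S) (hsum : ∑ s ∈ S, m s = q)
    (hA : ∑ s ∈ S, m s * s.1 = A₀) (hB : ∑ s ∈ S, m s * s.2 = A₀) (hAh : A₀ + A_h = q * (a * b))
    (hρ : ρ * ((q : ℝ) * a * b) = 2 * A_h) (hρ0 : 0 ≤ ρ) (hS : ∀ s ∈ S, s.1 ≤ a * b ∧ s.2 ≤ a * b)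
    {z : ℕ × ℕ → ℝ} (hz0 : ∀ s ∈ S, 0 < z s)
    (hz : ∀ s ∈ S, z s ≤ (partitionFn β (spinSectorHamiltonian (a * b - s.1) (a * b - s.2)
      (hubbardOpenBoxTT' a b t (-t') U))).re)
    {Ls : ℕ → ℕ} (hLs : Tendsto Ls atTop atTop) {ε : ℝ} (hε : 0 < ε) :
    ∀ᶠ j in atTop, ((((q : ℝ) * Real.log q - ∑ s ∈ S, (m s : ℝ) * Real.log (m s) +
        ∑ s ∈ S, (m s : ℝ) * Real.log (z s)) / ((q : ℝ) * a * b) - β * U * (1 - ρ)) - ε) * (Ls j : ℝ) ^ 2 ≤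
      Real.log (partitionFn β (sectorHamiltonianTT' t t' U (2 - ρ) (Ls j))).re := by
  have hAh' : (A_h : ℝ) = (q : ℝ) * (a * b) - A₀ := by
    have := congrArg (fun k : ℕ => (k : ℝ)) hAh
    push_cast at this
    linarith
  have hn : (2 - ρ) * ((q : ℝ) * a * b) = 2 * A₀ := by
    have : ρ * ((q : ℝ) * a * b) = 2 * ((q : ℝ) * (a * b) - A₀) := by rw [hρ, hAh']
    linarith
  have hn2 : 2 - ρ ≤ 2 := by linarith
  have h := InfVolFermionState.eventually_typeFreeEntropy_mul_sq_le_log_partitionFn_allTori_of_particleHole t t' U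
    (2 - ρ) hβ ha hb S m hq hmS hsum hA hB hn hn2 hS hz0 hz hLs hε
  have hshift : β * U * (1 - (2 - ρ)) = -(β * U * (1 - ρ)) := by ring
  simpa only [hshift, ← sub_eq_add_neg] using h

end ParticleHole

end Literature.MathematicalPhysics.QuantumLattice
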